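import Summits.AnomalousDissipation.AnomalousDissipation.Theorems.SolenoidalFractalHomogenisationLagrangianStepOneLevelSplitApi
import Summits.AnomalousDissipation.AnomalousDissipation.Theorems.SolenoidalFractalHomogenisationLagrangianStepDatumTrim
import Literature.Analysis.FluidPDE.StokesTorusDomainProofs
import Literature.Analysis.FunctionSpaces.TorusVectorParseval
import Literature.Analysis.FunctionSpaces.TorusSobolevNormFacts
import HarnessLib

/-!
# K1L_D (stmt-AnomalousDissipation-27980), stub `stub_windowFactsH`, task W0: ORTHOGONAL LABEL SPLITTINGS of `V2 = L²(𝕋³; ℝ³)`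
# (helper; `--supports … --as helper`; lead-k1l-onelevel-p1 g3)

The operator-level window facts (registry v6 `stub_windowFactsH`; glue `windowDefectH_of_windowFacts`, p665050) quantify over an orthogonal
three-way splitting `P ⊕ Q₁ ⊕ Q₂` of `V2` meant to be the Bloch-LABEL classes `‖lab‖ ≤ Lc/2`, `(Lc/2, Lg]`, `> Lg`.  This file constructs, for
ANY three pairwise disjoint, jointly exhaustive, SYMMETRIC (`k ∈ A ↔ −k ∈ A`) frequency sets `A, B, C ⊆ ℤ³`, continuous linear maps
`P, Q₁, Q₂ : V2 →L[ℝ] V2` with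
* the FOURIER CHARACTERISATION `𝓕(P y)(k) = 1_A(k) 𝓕(y)(k)` (same for `Q₁/B`, `Q₂/C`; `𝓕 y k := mFourierCoeff (complexify ∘ y) k`),
* `P y + Q₁ y + Q₂ y = y`, `‖y‖² = ‖P y‖² + ‖Q₁ y‖² + ‖Q₂ y‖²`, `⟪P y, Q₁ y′ + Q₂ y′⟫ = 0` (the three axioms of the stub text),
and the corollary the stub needs: `Q (datumLp w₁ hw₁) = 0` whenever `Q` has support `C ⊆ {k | Lc² < |k|²}` and `P_{Lc} w₁ = w₁`.
Route: SYNTHESIS — the coefficient family `1_A · 𝓕y` is conjugate-symmetric and square-summable, hence (Riesz–Fischer,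
`Torus.exists_forall_mFourierCoeff_eq_of_isConjSymm`) the coefficient family of a unique (Parseval) element of `V2`; linearity and the bound
`‖P y‖ ≤ ‖y‖` by uniqueness + Parseval (`Torus.hasSum_sq_norm_mFourierCoeff_complexify`, `…hasSum_re_inner_mFourierCoeff_complexify`).
No definitions (the maps are produced existentially), no named facts, no sorry.  NOT a proof of the stub, of the crux, or of AD; rung F-D1.A0.
-/

set_option linter.dupNamespace false

noncomputable section

namespace Summit.AnomalousDissipation.AnomalousDissipation.Theorems.SolenoidalFractalHomogenisation.LagrangianStep

open Literature.Analysis Literature.Analysis.FunctionSpaces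
open MeasureTheory Set Filter UnitAddTorus
open scoped ENNReal NNReal InnerProductSpace Classical
open OneLevelSplit

/-! ## §1 Fourier coefficient calculus on `V2` -/

/-- Elements of `V2` are integrable (finite measure). -/
theorem integrable_coe_V2 (y : V2) : Integrable (⇑y) volume := (Lp.memLp y).integrable one_le_two

/-- `𝓕(y + y′) = 𝓕 y + 𝓕 y′` on `V2`. -/
theorem fcoeff_add (y y' : V2) (k : Fin 3 → ℤ) :
    mFourierCoeff (EuclideanSpace.complexify ∘ ⇑(y + y')) k
      = mFourierCoeff (EuclideanSpace.complexify ∘ ⇑y) k + mFourierCoeff (EuclideanSpace.complexify ∘ ⇑y') k := by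
  have hae : (EuclideanSpace.complexify ∘ ⇑(y + y')) =ᵐ[volume]
      (EuclideanSpace.complexify ∘ ⇑y) + (EuclideanSpace.complexify ∘ ⇑y') := by
    filter_upwards [Lp.coeFn_add y y'] with x hx
    simp only [Function.comp_apply, hx, Pi.add_apply, map_add]
  rw [Torus.mFourierCoeff_congr_ae hae k]
  exact Torus.mFourierCoeff_add (Torus.integrable_complexify_comp (integrable_coe_V2 y))
    (Torus.integrable_complexify_comp (integrable_coe_V2 y')) k

/-- `𝓕(a • y) = a • 𝓕 y` on `V2` (`a` real). -/
theorem fcoeff_smul (a : ℝ) (y : V2) (k : Fin 3 → ℤ) :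
    mFourierCoeff (EuclideanSpace.complexify ∘ ⇑(a • y)) k = (a : ℂ) • mFourierCoeff (EuclideanSpace.complexify ∘ ⇑y) k := by
  have hae : (EuclideanSpace.complexify ∘ ⇑(a • y)) =ᵐ[volume] (a : ℂ) • (EuclideanSpace.complexify ∘ ⇑y) := by
    filter_upwards [Lp.coeFn_smul a y] with x hx
    simp only [Function.comp_apply, hx, Pi.smul_apply]
    ext i
    simp [EuclideanSpace.complexify_apply]
  rw [Torus.mFourierCoeff_congr_ae hae k, Torus.mFourierCoeff_const_smul]

/-- `𝓕(y − y′) = 𝓕 y − 𝓕 y′` on `V2`. -/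
theorem fcoeff_sub (y y' : V2) (k : Fin 3 → ℤ) :
    mFourierCoeff (EuclideanSpace.complexify ∘ ⇑(y - y')) k
      = mFourierCoeff (EuclideanSpace.complexify ∘ ⇑y) k - mFourierCoeff (EuclideanSpace.complexify ∘ ⇑y') k := by
  have hae : (EuclideanSpace.complexify ∘ ⇑(y - y')) =ᵐ[volume]
      (EuclideanSpace.complexify ∘ ⇑y) - (EuclideanSpace.complexify ∘ ⇑y') := by
    filter_upwards [Lp.coeFn_sub y y'] with x hx
    simp only [Function.comp_apply, hx, Pi.sub_apply, map_sub]
  rw [Torus.mFourierCoeff_congr_ae hae k]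
  exact Torus.mFourierCoeff_sub (Torus.integrable_complexify_comp (integrable_coe_V2 y))
    (Torus.integrable_complexify_comp (integrable_coe_V2 y')) k

/-- Parseval on `V2`: `‖y‖² = Σ_k ‖𝓕 y k‖²` as a `HasSum`. -/
theorem hasSum_norm_sq_fcoeff (y : V2) :
    HasSum (fun k : Fin 3 → ℤ => ‖mFourierCoeff (EuclideanSpace.complexify ∘ ⇑y) k‖ ^ 2) (‖y‖ ^ 2) := by
  rw [norm_sq_eq_integral]
  exact Torus.hasSum_sq_norm_mFourierCoeff_complexify (Lp.memLp y)

/-- Parseval for inner products on `V2`: `⟪y, y′⟫ = Σ_k Re ⟪𝓕 y k, 𝓕 y′ k⟫_ℂ` as a `HasSum`. -/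
theorem hasSum_inner_fcoeff (y y' : V2) :
    HasSum (fun k : Fin 3 → ℤ => (inner ℂ (mFourierCoeff (EuclideanSpace.complexify ∘ ⇑y) k)
      (mFourierCoeff (EuclideanSpace.complexify ∘ ⇑y') k)).re) (⟪y, y'⟫_ℝ) := by
  rw [MeasureTheory.L2.inner_def]
  exact Torus.hasSum_re_inner_mFourierCoeff_complexify (Lp.memLp y) (Lp.memLp y')

/-- Uniqueness: two elements of `V2` with the same Fourier coefficients are equal. -/
theorem eq_of_fcoeff_eq {y y' : V2}
    (h : ∀ k, mFourierCoeff (EuclideanSpace.complexify ∘ ⇑y) k = mFourierCoeff (EuclideanSpace.complexify ∘ ⇑y') k) : y = y' := by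
  have hP := hasSum_norm_sq_fcoeff (y - y')
  have h0 : (fun k : Fin 3 → ℤ => ‖mFourierCoeff (EuclideanSpace.complexify ∘ ⇑(y - y')) k‖ ^ 2) = fun _ => 0 := by
    funext k; rw [fcoeff_sub, h k, sub_self, norm_zero]; ring
  rw [h0] at hP
  have h1 : ‖y - y'‖ ^ 2 = 0 := hP.unique hasSum_zero |>.symm ▸ rfl
  have h2 : ‖y - y'‖ = 0 := by
    rcases (sq_eq_zero_iff.mp h1) with h; exact h
  exact sub_eq_zero.mp (norm_eq_zero.mp h2)

/-! ## §2 One label projector (synthesis) -/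

/-- **The projector onto a symmetric frequency set.**  For `A ⊆ ℤ³` with `k ∈ A ↔ −k ∈ A` there is a continuous linear `P : V2 →L[ℝ] V2`
with `𝓕(P y)(k) = if k ∈ A then 𝓕(y)(k) else 0`. -/
theorem exists_labelProj (A : Set (Fin 3 → ℤ)) (hA : ∀ k, k ∈ A ↔ -k ∈ A) :
    ∃ P : V2 →L[ℝ] V2, ∀ (y : V2) (k : Fin 3 → ℤ),
      mFourierCoeff (EuclideanSpace.complexify ∘ ⇑(P y)) k
        = if k ∈ A then mFourierCoeff (EuclideanSpace.complexify ∘ ⇑y) k else 0 := by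
  classical
  -- the truncated coefficient family of `y` is conjugate-symmetric and square-summable, hence that of an element of `V2`
  have hex : ∀ y : V2, ∃ w : V2, ∀ k, mFourierCoeff (EuclideanSpace.complexify ∘ ⇑w) k
      = if k ∈ A then mFourierCoeff (EuclideanSpace.complexify ∘ ⇑y) k else 0 := by
    intro y
    have hsymm : Torus.IsConjSymm (fun k => if k ∈ A then mFourierCoeff (EuclideanSpace.complexify ∘ ⇑y) k else 0) := by
      intro k
      have hy := Torus.isConjSymm_mFourierCoeff (integrable_coe_V2 y) k
      by_cases hk : k ∈ A
      · have hk' : -k ∈ A := (hA k).1 hk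
        simp only [hk, hk', if_true]
        exact hy
      · have hk' : -k ∉ A := fun h => hk (by have := (hA (-k)).1 h; simpa using this)
        simp only [hk, hk', if_false]
        ext i; simp
    have hsum : Summable (fun k => ‖(if k ∈ A then mFourierCoeff (EuclideanSpace.complexify ∘ ⇑y) k else 0)‖ ^ 2) := by
      refine Summable.of_nonneg_of_le (fun k => sq_nonneg _) (fun k => ?_) (hasSum_norm_sq_fcoeff y).summable
      split_ifs
      · exact le_rfl
      · rw [norm_zero, zero_pow two_ne_zero]; positivity
    exact FluidPDE.Torus.exists_forall_mFourierCoeff_eq_of_isConjSymm hsymm hsum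
  choose w hw using hex
  -- linearity by uniqueness of coefficients
  have hadd : ∀ y y', w (y + y') = w y + w y' := by
    intro y y'
    refine eq_of_fcoeff_eq fun k => ?_
    rw [hw, fcoeff_add, fcoeff_add, hw, hw]
    split_ifs <;> simp
  have hsmul : ∀ (a : ℝ) y, w (a • y) = a • w y := by
    intro a y
    refine eq_of_fcoeff_eq fun k => ?_
    rw [hw, fcoeff_smul, fcoeff_smul, hw]
    split_ifs <;> simp
  -- the bound `‖w y‖ ≤ ‖y‖` by Parseval
  have hbound : ∀ y, ‖w y‖ ≤ ‖y‖ := by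
    intro y
    have h1 := hasSum_norm_sq_fcoeff (w y)
    have h2 := hasSum_norm_sq_fcoeff y
    have hle : ‖w y‖ ^ 2 ≤ ‖y‖ ^ 2 := by
      refine hasSum_le (fun k => ?_) h1 h2
      rw [hw]
      split_ifs
      · exact le_rfl
      · rw [norm_zero, zero_pow two_ne_zero]; positivity
    have := Real.sqrt_le_sqrt hle
    rwa [Real.sqrt_sq (norm_nonneg _), Real.sqrt_sq (norm_nonneg _)] at this
  let L : V2 →ₗ[ℝ] V2 := { toFun := w, map_add' := hadd, map_smul' := hsmul }
  refine ⟨L.mkContinuous 1 (fun y => by rw [one_mul]; exact hbound y), fun y k => ?_⟩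
  exact hw y k

/-! ## §3 The three-way splitting -/

/-- Termwise-zero real parts sum to zero: orthogonality of elements with disjoint coefficient supports. -/
theorem inner_eq_zero_of_disjoint_fcoeff {f g : V2}
    (h : ∀ k, mFourierCoeff (EuclideanSpace.complexify ∘ ⇑f) k = 0 ∨ mFourierCoeff (EuclideanSpace.complexify ∘ ⇑g) k = 0) :
    ⟪f, g⟫_ℝ = 0 := by
  have hP := hasSum_inner_fcoeff f g
  have h0 : (fun k : Fin 3 → ℤ => (inner ℂ (mFourierCoeff (EuclideanSpace.complexify ∘ ⇑f) k)
      (mFourierCoeff (EuclideanSpace.complexify ∘ ⇑g) k)).re) = fun _ => 0 := by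
    funext k
    rcases h k with hk | hk <;> simp [hk]
  rw [h0] at hP
  exact hP.unique hasSum_zero

/-- **THE THREE-WAY LABEL SPLITTING.**  Pairwise disjoint, jointly exhaustive, symmetric `A, B, C ⊆ ℤ³` give `P, Q₁, Q₂ : V2 →L[ℝ] V2` with the
three axioms of `stub_windowFactsH` and the Fourier characterisation. -/
theorem exists_labelSplit (A B C : Set (Fin 3 → ℤ)) (hA : ∀ k, k ∈ A ↔ -k ∈ A) (hB : ∀ k, k ∈ B ↔ -k ∈ B) (hC : ∀ k, k ∈ C ↔ -k ∈ C)
    (hAB : ∀ k, k ∈ A → k ∉ B) (hAC : ∀ k, k ∈ A → k ∉ C) (hBC : ∀ k, k ∈ B → k ∉ C) (hcover : ∀ k, k ∈ A ∨ k ∈ B ∨ k ∈ C) :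
    ∃ P Q₁ Q₂ : V2 →L[ℝ] V2,
      (∀ y : V2, P y + Q₁ y + Q₂ y = y) ∧ (∀ y : V2, ‖y‖ ^ 2 = ‖P y‖ ^ 2 + ‖Q₁ y‖ ^ 2 + ‖Q₂ y‖ ^ 2) ∧
      (∀ y y' : V2, ⟪P y, Q₁ y' + Q₂ y'⟫_ℝ = 0) ∧
      (∀ (y : V2) (k : Fin 3 → ℤ), mFourierCoeff (EuclideanSpace.complexify ∘ ⇑(P y)) k
        = if k ∈ A then mFourierCoeff (EuclideanSpace.complexify ∘ ⇑y) k else 0) ∧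
      (∀ (y : V2) (k : Fin 3 → ℤ), mFourierCoeff (EuclideanSpace.complexify ∘ ⇑(Q₁ y)) k
        = if k ∈ B then mFourierCoeff (EuclideanSpace.complexify ∘ ⇑y) k else 0) ∧
      (∀ (y : V2) (k : Fin 3 → ℤ), mFourierCoeff (EuclideanSpace.complexify ∘ ⇑(Q₂ y)) k
        = if k ∈ C then mFourierCoeff (EuclideanSpace.complexify ∘ ⇑y) k else 0) := by
  classical
  obtain ⟨P, hP⟩ := exists_labelProj A hA
  obtain ⟨Q₁, hQ₁⟩ := exists_labelProj B hB
  obtain ⟨Q₂, hQ₂⟩ := exists_labelProj C hC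
  -- `P + Q₁ + Q₂ = id`
  have hsum : ∀ y : V2, P y + Q₁ y + Q₂ y = y := by
    intro y
    refine eq_of_fcoeff_eq fun k => ?_
    rw [fcoeff_add, fcoeff_add, hP, hQ₁, hQ₂]
    rcases hcover k with hk | hk | hk
    · simp [hk, hAB k hk, hAC k hk]
    · have hkA : k ∉ A := fun h => hAB k h hk
      simp [hk, hkA, hBC k hk]
    · have hkA : k ∉ A := fun h => hAC k h hk
      have hkB : k ∉ B := fun h => hBC k h hk
      simp [hk, hkA, hkB]
  -- pairwise orthogonality of the ranges
  have hPQ₁ : ∀ y y', ⟪P y, Q₁ y'⟫_ℝ = 0 := fun y y' =>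
    inner_eq_zero_of_disjoint_fcoeff fun k => by
      rw [hP, hQ₁]
      by_cases hk : k ∈ A
      · right; simp [hAB k hk]
      · left; simp [hk]
  have hPQ₂ : ∀ y y', ⟪P y, Q₂ y'⟫_ℝ = 0 := fun y y' =>
    inner_eq_zero_of_disjoint_fcoeff fun k => by
      rw [hP, hQ₂]
      by_cases hk : k ∈ A
      · right; simp [hAC k hk]
      · left; simp [hk]
  have hQ₁Q₂ : ∀ y y', ⟪Q₁ y, Q₂ y'⟫_ℝ = 0 := fun y y' =>
    inner_eq_zero_of_disjoint_fcoeff fun k => by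
      rw [hQ₁, hQ₂]
      by_cases hk : k ∈ B
      · right; simp [hBC k hk]
      · left; simp [hk]
  have horth : ∀ y y' : V2, ⟪P y, Q₁ y' + Q₂ y'⟫_ℝ = 0 := fun y y' => by
    rw [inner_add_right, hPQ₁, hPQ₂, add_zero]
  refine ⟨P, Q₁, Q₂, hsum, fun y => ?_, horth, hP, hQ₁, hQ₂⟩
  -- Pythagoras
  have e : y = P y + (Q₁ y + Q₂ y) := by rw [← add_assoc, hsum]
  have h1 : ‖P y + (Q₁ y + Q₂ y)‖ ^ 2 = ‖P y‖ ^ 2 + 2 * ⟪P y, Q₁ y + Q₂ y⟫_ℝ + ‖Q₁ y + Q₂ y‖ ^ 2 := norm_add_sq_real _ _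
  have h2 : ‖Q₁ y + Q₂ y‖ ^ 2 = ‖Q₁ y‖ ^ 2 + 2 * ⟪Q₁ y, Q₂ y⟫_ℝ + ‖Q₂ y‖ ^ 2 := norm_add_sq_real _ _
  rw [horth] at h1
  rw [hQ₁Q₂] at h2
  conv_lhs => rw [e]
  rw [h1, h2]; ring

/-! ## §4 Band-limited data have no content in a far class -/

/-- If `Q` only keeps coefficients in `C ⊆ {k | Lc² < |k|²}` and the datum is band-limited at `Lc`, then `Q x₁ = 0`. -/
theorem labelProj_datum_eq_zero {C : Set (Fin 3 → ℤ)} {Lc : ℕ} (hC : ∀ k ∈ C, ((Lc : ℝ)) ^ 2 < Torus.freqNormSq k)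
    {Q : V2 →L[ℝ] V2}
    (hQ : ∀ (y : V2) (k : Fin 3 → ℤ), mFourierCoeff (EuclideanSpace.complexify ∘ ⇑(Q y)) k
        = if k ∈ C then mFourierCoeff (EuclideanSpace.complexify ∘ ⇑y) k else 0)
    (w₁ : VF) (hw₁ : IsDatum w₁) (hband : Torus.fourierTruncate Lc w₁ = w₁) :
    Q (datumLp w₁ hw₁) = 0 := by
  classical
  refine eq_of_fcoeff_eq fun k => ?_
  have h0 : mFourierCoeff (EuclideanSpace.complexify ∘ ⇑(0 : V2)) k = 0 := by
    have hae : (EuclideanSpace.complexify ∘ ⇑(0 : V2)) =ᵐ[volume] (fun _ => (0 : EuclideanSpace ℂ (Fin 3))) := by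
      filter_upwards [Lp.coeFn_zero (EuclideanSpace ℝ (Fin 3)) 2 volume] with x hx
      simp only [Function.comp_apply, hx, Pi.zero_apply, map_zero]
    rw [Torus.mFourierCoeff_congr_ae hae k]
    simp [mFourierCoeff]
  rw [h0, hQ]
  split_ifs with hk
  · -- the datum has no coefficient at `k`
    have hae : (EuclideanSpace.complexify ∘ ⇑(datumLp w₁ hw₁)) =ᵐ[volume] (EuclideanSpace.complexify ∘ Torus.fourierTruncate Lc w₁) := by
      filter_upwards [coeFn_datumLp w₁ hw₁] with x hx
      simp only [Function.comp_apply, hx, hband]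
    rw [Torus.mFourierCoeff_congr_ae hae k]
    exact mFourierCoeff_fourierTruncate_eq_zero (hw₁.memLp_two.integrable one_le_two) Lc (hC k hk)
  · rfl

end Summit.AnomalousDissipation.AnomalousDissipation.Theorems.SolenoidalFractalHomogenisation.LagrangianStep

end
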